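import Summits.QuantumFields.BalabanUV.Beta.FP.NestedColumnCombDead
import Summits.QuantumFields.BalabanUV.Beta.FP.TorusCompositeObjects

/-!
# `BalabanUV.Beta.FP.NestedColumnCombDeadTower` — road «FP» for binder row D1, ROUTE T: **`hdead` FOR THE NESTED COLUMN OVER ANY FINE SYSTEM — THE
# COMPOSITE DOOR's (#21) TRANSPORTED DIRECTION `compRows · h` IS AVERAGE-COARSE-COMB-DEAD** (the fine-index-generic twin of the OWNER d1-p3 g22's #29
# `NestedColumnCombDead.hdead_of_nested_column`, both spellings; instance at leaf-06 g20's tower objects `compRows ∕ bigP ∕ combF`)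

WHY.  #29 (p341345 ✓) gives U18∕U20∕U21's `hdead : Σ_b Q₁₀ a b·h b = 0` at every coarse comb bond for the m = 1 nested column
`h := minOp H₀ [Q₁₀; τ₁]·(minOp S₁₁ [Q₂₀; τ₂]·(h̄, 0), 0)` — typed at the ONE-STEP fine system (`Q₁₀` on `fine Lc M′`, `τ₁` the small-comb rows).  My
`FP/NestedDeadRowsOrderTwo` §3 (INTENT 1 l.47847, junction J2) reads the COMPOSITE door #21's `uTop` slot under the composite deadness
`(compRows Lc M′ lev rs (n+1) *ᵥ h) a = 0` at the TOP comb bonds; this file discharges that hypothesis for #21's nested column by the SAME two KKT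
non-degeneracies, with NO new argument: #29's §1 (`nested_column_rows`, `apply_eq_zero_of_coordRows_mulVec_eq_zero`, `fieldSlot_injective`) is already
fine-index-generic — only its §2 wrapper fixed the fine types.
* §1 `hdead_of_nested_column_mulVec` ∕ `hdead_of_nested_column_sum` — #29's theorem with the FINE system generic: `H₀ : Matrix ν ν ℝ`, `Q₁₀ : Matrix
  (coarse bonds) ν ℝ`, `τ₁ : Matrix R ν ℝ` for ANY finite `ν R` (`*ᵥ` and `Σ` spellings; the coarse side — `S₁₁ Q₂₀`, the comb rows `τ₂` in the door's
  spelling, root-generic site `ρ` — VERBATIM #29's).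
* §2 **`hdead_of_nested_column_tower`** — the instance at #21's letters: `Q₁₀ := compRows Lc M′ lev rs (n+1)`, `τ₁ := bigP Lc M′ rs _ (n+1)` (R-FP-55 (α):
  the one-shot big comb of the tower; ANY `hrs`), `τ₂ := combF Lc M′ (rs 0)` (#21's `hτ₂`), `H₀ S₁₁ Q₂₀` free: for every `h̄`, the nested composite column
  `h := minOp H₀ [compRows; bigP]·(minOp S₁₁ [Q₂₀; combF]·(h̄, 0), 0)` has `(compRows *ᵥ h) a = 0` at every top comb bond — `FP/NestedDeadRowsOrderTwo`
  §3∕§4's `hdead` for #21, and `CoarseFPExponential.torus_uTop_of_dead`'s `hDb₁` once leaf-02 C2's `D̄₁ = −(c·(compRows·h) a·[tip])` is bound.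
[folklore] linear algebra BY NAME over #29 and `CompositionSingular`; no `def`, no `def … : Prop`, nothing cited, 0 sorry.  NOT HERE: the two KKT
non-degeneracies themselves (leaf-05's (T-INV) letters `torus_composite_inv_and_eff` ∕ `RelInvPeriodised*` supply them at the record; displayed), any
order-2 deadness (the remainder `V` of `FP/NestedDeadRowsOrderTwo` is NOT comb-dead by this argument — located in W-3 l.47660), anything of the dictionary.

HONEST DEPENDENCY (page 1, mandatory): continuum YM on T⁴ ⇐ BetaPertH ∧ nine spine estimates (0/9 proved); BetaPertH ⇐ (D1) ∧ (D4) ∧ CAP+tail;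
G-an2-4 gates asym, D1 and NE2/3/4.  HONEST FRAMING (cell contract, verbatim): «discharging `BetaPertH` makes Bałaban's UV stability UNCONDITIONAL —
a real constructive-QFT result; it is NOT the continuum limit and NOT the Clay problem.»  ABSOLUTE RULE (cell charter, verbatim): «No internally-minted
statement may enter as a cited fact. Every hypothesis is either kernel-proved in this package or a verbatim quotation of a PUBLISHED theorem with page
reference. The manuscript(s) under audit are NOT citable for their own disputed steps — they are the thing under adjudication; programme-internal
(2001/route/tribunal) claims are never citable.»  0 estimates; 0∕4 row-D1 binders (hW, hR, D1Tel, D1Rep); NOT the dictionary, NOT (T-ID)∕(T-β)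
complete, NOT SDF, NOT D1, NOT BetaPertH, NOT continuum, NOT Clay.  «not in print; our bookkeeping».
Provenance: D1 formalisation swarm LEAF PROVER 06, unit b2b-balaban-beta-d1-formalise-leaf-06 gen 24, 2026-08-22∕23.  No existing file touched.
-/

noncomputable section

open scoped BigOperators Matrix

namespace Summit.QuantumFields.BalabanUV.Beta.FP.NestedColumnCombDeadTower

open Matrix
open Literature.MathematicalPhysics.QuantumFieldTheory.Balaban1983to89
open Literature.MathematicalPhysics.QuantumFieldTheory.Balaban1983to89.Beta
open Literature.MathematicalPhysics.QuantumFieldTheory.Balaban1983to89.Beta.Composition (kkt)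
open Literature.MathematicalPhysics.QuantumFieldTheory.Balaban1983to89.Beta.CompositionSingular (minOp)
open AffineAveraging (Site box toSite)
open B6Lemma24Torus (pbox)
open OneStepResolventKernel (Fib)
open Summit.QuantumFields.BalabanUV.Beta.FP.KernelPeriodisationFib (Idx)
open Summit.QuantumFields.BalabanUV.Beta.FP.TorusCombRows (Res combRowsT combBondT)
open Summit.QuantumFields.BalabanUV.Beta.FP.NestedColumnCombDead (nested_column_rows apply_eq_zero_of_coordRows_mulVec_eq_zero fieldSlot_injective)
open Summit.QuantumFields.BalabanUV.Beta.FP.TorusCompositeObjects (towerTorus compRows NParam bigP combF)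
open Summit.QuantumFields.BalabanUV.Beta.GAN24.FineReadoutCauchyFrame (toSite_mem_range)

variable {d : ℕ}

/-! ## §1 `hdead` for the nested column over ANY fine system -/

section Generic

variable (M' : Fin (d + 1) → ℕ) {Lc : ℕ} (ρ : Site (d + 1))

set_option synthInstance.maxSize 1024 in
/-- [folklore] **`hdead` FOR THE NESTED COLUMN, FINE SYSTEM GENERIC, `*ᵥ` SPELLING.**  Fine system `(H₀, [Q₁₀; τ₁])` on ANY finite index types `ν`
(fine bonds) and `R` (fine residual parameters), coarse system `(S₁₁, [Q₂₀; τ₂])` with `τ₂` the coarse comb coordinate rows in the door's spelling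
(root-generic site `ρ`), both KKT-non-degenerate; then for every top direction `h̄` the nested column's fine field `h := minOp H₀ [Q₁₀; τ₁]·(minOp S₁₁ [Q₂₀;
τ₂]·(h̄, 0), 0)` has `(Q₁₀ *ᵥ h) a = 0` at every coarse comb bond `a` — #29's proof verbatim (`Q₁₀·h = v`, `τ₂·v = 0`, the comb rows are coordinate
functionals). -/
theorem hdead_of_nested_column_mulVec {ν R κ : Type*} [Fintype ν] [DecidableEq ν] [Fintype R] [DecidableEq R] [Fintype κ] [DecidableEq κ]
    (H₀ : Matrix ν ν ℝ) (Q₁₀ : Matrix (↥(pbox M') × Fin (d + 1)) ν ℝ) (τ₁ : Matrix R ν ℝ)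
    (S₁₁ : Matrix (↥(pbox M') × Fin (d + 1)) (↥(pbox M') × Fin (d + 1)) ℝ) (Q₂₀ : Matrix κ (↥(pbox M') × Fin (d + 1)) ℝ)
    {τ₂ : Matrix (Res ρ Lc M') (↥(pbox M') × Fin (d + 1)) ℝ}
    (hτ₂ : τ₂ = (combRowsT ρ Lc M').submatrix id (fun b : ↥(pbox M') × Fin (d + 1) => ((b.1, Sum.inl b.2) : Idx M' (Fib d))))
    (h₁ : IsUnit (kkt H₀ (fromRows Q₁₀ τ₁)).det) (h₂ : IsUnit (kkt S₁₁ (fromRows Q₂₀ τ₂)).det)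
    (hbar : κ → ℝ)
    {v : ↥(pbox M') × Fin (d + 1) → ℝ} (hv : v = minOp S₁₁ (fromRows Q₂₀ τ₂) *ᵥ Sum.elim hbar 0)
    {h : ν → ℝ} (hh : h = minOp H₀ (fromRows Q₁₀ τ₁) *ᵥ Sum.elim v 0) :
    ∀ (a : ↥(pbox M') × Fin (d + 1)) (x : Res ρ Lc M'),
      combBondT ρ Lc M' x = ((a.1, Sum.inl a.2) : Idx M' (Fib d)) → (Q₁₀ *ᵥ h) a = 0 := by
  intro a x hx
  obtain ⟨hQ₁, -, -, hτ₂v⟩ := nested_column_rows H₀ Q₁₀ τ₁ S₁₁ Q₂₀ τ₂ h₁ h₂ hbar hv hh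
  rw [hQ₁]
  have hτ₂' : τ₂ = Matrix.of fun (x : Res ρ Lc M') (b : ↥(pbox M') × Fin (d + 1)) =>
      if ((b.1, Sum.inl b.2) : Idx M' (Fib d)) = combBondT ρ Lc M' x then (1 : ℝ) else 0 := by
    rw [hτ₂]
    ext x b
    simp [combRowsT, Matrix.submatrix]
  exact apply_eq_zero_of_coordRows_mulVec_eq_zero (fun b : ↥(pbox M') × Fin (d + 1) => ((b.1, Sum.inl b.2) : Idx M' (Fib d)))
    (fieldSlot_injective M') (combBondT ρ Lc M') hτ₂' hτ₂v hx

set_option synthInstance.maxSize 1024 in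
/-- [folklore] **The same in U18∕U20∕U21's `Σ` spelling** (`Σ_b Q₁₀ a b·h b = 0` at every coarse comb bond) — #29's `hdead_of_nested_column` is the
instance `ν := bonds of fine Lc M′`, `R := Res ρ Lc (fine Lc M′)`. -/
theorem hdead_of_nested_column_sum {ν R κ : Type*} [Fintype ν] [DecidableEq ν] [Fintype R] [DecidableEq R] [Fintype κ] [DecidableEq κ]
    (H₀ : Matrix ν ν ℝ) (Q₁₀ : Matrix (↥(pbox M') × Fin (d + 1)) ν ℝ) (τ₁ : Matrix R ν ℝ)
    (S₁₁ : Matrix (↥(pbox M') × Fin (d + 1)) (↥(pbox M') × Fin (d + 1)) ℝ) (Q₂₀ : Matrix κ (↥(pbox M') × Fin (d + 1)) ℝ)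
    {τ₂ : Matrix (Res ρ Lc M') (↥(pbox M') × Fin (d + 1)) ℝ}
    (hτ₂ : τ₂ = (combRowsT ρ Lc M').submatrix id (fun b : ↥(pbox M') × Fin (d + 1) => ((b.1, Sum.inl b.2) : Idx M' (Fib d))))
    (h₁ : IsUnit (kkt H₀ (fromRows Q₁₀ τ₁)).det) (h₂ : IsUnit (kkt S₁₁ (fromRows Q₂₀ τ₂)).det)
    (hbar : κ → ℝ)
    {v : ↥(pbox M') × Fin (d + 1) → ℝ} (hv : v = minOp S₁₁ (fromRows Q₂₀ τ₂) *ᵥ Sum.elim hbar 0)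
    {h : ν → ℝ} (hh : h = minOp H₀ (fromRows Q₁₀ τ₁) *ᵥ Sum.elim v 0) :
    ∀ (a : ↥(pbox M') × Fin (d + 1)) (x : Res ρ Lc M'),
      combBondT ρ Lc M' x = ((a.1, Sum.inl a.2) : Idx M' (Fib d)) → ∑ b, Q₁₀ a b * h b = 0 := by
  intro a x hx
  have e : ∑ b, Q₁₀ a b * h b = (Q₁₀ *ᵥ h) a := by rw [mulVec, dotProduct]
  rw [e]
  exact hdead_of_nested_column_mulVec M' ρ H₀ Q₁₀ τ₁ S₁₁ Q₂₀ hτ₂ h₁ h₂ hbar hv hh a x hx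

end Generic

/-! ## §2 The instance at the composite door #21: the transported direction `compRows · h` of the nested composite column is comb-dead -/

section Tower

variable (M' : Fin (d + 1) → ℕ) [∀ μ, NeZero (M' μ)] (Lc : ℕ) [NeZero Lc] (lev : ℕ → ℕ) (rs : ℕ → (Fin (d + 1) → ℕ)) (n : ℕ)

set_option synthInstance.maxSize 1024 in
/-- [folklore] **`hdead_of_nested_column_tower` — THE COMPOSITE DOOR's `hdead`.**  At #21's letters (`Q₁₀ := compRows Lc M′ lev rs (n+1)` the `(n+1)`-fold
composite averaging, `τ₁ := bigP Lc M′ rs hrs (n+1)` the one-shot big comb of the tower (R-FP-55 (α); ANY admissible `hrs`), `τ₂ := combF Lc M′ (rs 0)` the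
top comb rows; `H₀ S₁₁ Q₂₀` free), both systems KKT-non-degenerate: for every top direction `h̄` the nested composite column
`h := minOp H₀ [compRows; bigP]·(minOp S₁₁ [Q₂₀; combF]·(h̄, 0), 0)` on the finest torus satisfies `(compRows … *ᵥ h) a = 0` at every TOP comb bond `a` —
the `hdead` of `FP/NestedDeadRowsOrderTwo` §3∕§4 (junction J2) and, with leaf-02 C2's `D̄₁ = −(c·(compRows·h) a·[tip])`, `CoarseFPExponential`'s dead `hDb₁`. -/
theorem hdead_of_nested_column_tower {κ : Type*} [Fintype κ] [DecidableEq κ]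
    (hrs : ∀ k i, 0 ≤ toSite (rs k) i ∧ toSite (rs k) i < (Lc : ℤ))
    (H₀ : Matrix (↥(pbox (towerTorus Lc M' (n + 1))) × Fin (d + 1)) (↥(pbox (towerTorus Lc M' (n + 1))) × Fin (d + 1)) ℝ)
    (S₁₁ : Matrix (↥(pbox M') × Fin (d + 1)) (↥(pbox M') × Fin (d + 1)) ℝ) (Q₂₀ : Matrix κ (↥(pbox M') × Fin (d + 1)) ℝ)
    {Q₁₀ : Matrix (↥(pbox M') × Fin (d + 1)) (↥(pbox (towerTorus Lc M' (n + 1))) × Fin (d + 1)) ℝ} (hQ₁₀ : Q₁₀ = compRows Lc M' lev rs (n + 1))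
    {τ₁ : Matrix (NParam Lc M' rs (n + 1)) (↥(pbox (towerTorus Lc M' (n + 1))) × Fin (d + 1)) ℝ} (hτ₁ : τ₁ = bigP Lc M' rs hrs (n + 1))
    {τ₂ : Matrix (Res (toSite (rs 0)) Lc M') (↥(pbox M') × Fin (d + 1)) ℝ} (hτ₂ : τ₂ = combF Lc M' (rs 0))
    (h₁ : IsUnit (kkt H₀ (fromRows Q₁₀ τ₁)).det) (h₂ : IsUnit (kkt S₁₁ (fromRows Q₂₀ τ₂)).det)
    (hbar : κ → ℝ)
    {v : ↥(pbox M') × Fin (d + 1) → ℝ} (hv : v = minOp S₁₁ (fromRows Q₂₀ τ₂) *ᵥ Sum.elim hbar 0)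
    {h : ↥(pbox (towerTorus Lc M' (n + 1))) × Fin (d + 1) → ℝ} (hh : h = minOp H₀ (fromRows Q₁₀ τ₁) *ᵥ Sum.elim v 0) :
    ∀ (a : ↥(pbox M') × Fin (d + 1)) (x : Res (toSite (rs 0)) Lc M'),
      combBondT (toSite (rs 0)) Lc M' x = ((a.1, Sum.inl a.2) : Idx M' (Fib d)) → (compRows Lc M' lev rs (n + 1) *ᵥ h) a = 0 := by
  subst hQ₁₀ hτ₁
  exact hdead_of_nested_column_mulVec M' (toSite (rs 0)) H₀ (compRows Lc M' lev rs (n + 1)) (bigP Lc M' rs hrs (n + 1)) S₁₁ Q₂₀ hτ₂ h₁ h₂ hbar hv hh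

end Tower

end Summit.QuantumFields.BalabanUV.Beta.FP.NestedColumnCombDeadTower

end
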